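import Summits.CriticalPhenomena.PercolationContinuityZ3.Theorems.PercNearOneGluingNoHeavyLowerTailKnQuestion8CoefficientwiseIslandMax
import Summits.CriticalPhenomena.PercolationContinuityZ3.Theorems.PercNearOneGluingNoHeavyLowerTailDualBHKBlock
import Summits.CriticalPhenomena.PercolationContinuityZ3.Theorems.PercNearOneGluingNoHeavyLowerTailKnQuestion8CoefficientwiseGluing
import HarnessLib

/-!
# Islands III-a: the class of a maximal island (prim-lf-2 gen 36, memo CW-RESIDUE-gen36 §2)

Support file (`--supports stmt-CriticalPhenomena-4575`, closed), prover `prim-lf-2` (gen 36).  No definitions, no named facts,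
      no sorries; standard axioms.

Setting as in …CoefficientwiseIsland / …IslandMax: multigraph `ends : ι
      → Sym2 V`, vertex finset `Vs ∋ x`, edge set `E`, root `x`, points `u, w` (`w ≠ x`), wall set `Z`;
colourings `s ⊆ E`; `C(t) = openCluster (ends '' t) x`; `σ_v(s) = 1[v ∈ C(s)] − 1[v ∈ C(E \ s)]`; point row `P = Σ_{s : Z off the zone} σ_u σ_w`.  For
`Y ⊆ Vs` with `x ∈ Y ∌ w`: `E_Y` = edges inside `Y`; `N_isl(Y)` = number of colourings `s₀
      ⊆ E_Y` for which `Y` is an island (every boundary vertex red- and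
blue-reachable from `x` inside `Y`) and the wall vertices in `Y` are off the zone; the QUOTIENT colourings are `s₁
      ⊆ E \ E_Y` read with all of `E_Y` in both colours;
`s₁` is PRIME if no `Y'` with `Y ⊊ Y' ⊆ Vs`, `w ∉ Y'` is an island of the quotient colouring; `R_Y`
      = `Σ` over the prime quotient colourings with the wall
vertices outside `Y` off the zone of `σ_u σ_w` (read on the quotient).
* `Coefficientwise.islandClass_sum` — for `u ∉ Y`: the point-row sum over the wall colourings whose MAXIMAL island is `Y` equals `N_isl(Y) · R_Y`
  (…IslandMax `islandSup_eq_iff` + Lemma B `island_iff_quotient_of_subset` + Lemma A);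
* `Coefficientwise.islandClass_sum_eq_zero` — for `u ∈ Y` that sum vanishes (σ_u is read inside the island, σ_w on the quotient,
      and the quotient colour swap
  preserves primality and the wall);
* `Coefficientwise.pointRow_eq_sum_islands` — **ISLAND FACTORISATION**:  `P(G;x,Z;u,w) = Σ_{Y ⊆ Vs : x ∈ Y, u,w ∉ Y} N_isl(Y) · R_Y`.
Since every `N_isl(Y) ≥ 0`, CONJECTURE PRIME POSITIVITY (`R ≥ 0` for every rooted multigraph, wall set and points; census memo §3: 0 negatives through
n = 7 all m, n = 8 m ≤ 12, structured families,
      random n ≤ 12) implies the point row of the coefficientwise programme for every graph and every wall set —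
`Coefficientwise.pointRow_nonneg_of_prime_nonneg`.
[cite: KozmaNitzan2024, Questions 8–9 (§5.5 p. 36) (context: the Question-8 pocket covariance programme)]
-/

namespace Summit.CriticalPhenomena.PercolationContinuityZ3.Theorems

open Finset Literature.Probability.Percolation

namespace Coefficientwise

variable {ι V : Type*}

open Classical in
/-- Pointwise bookkeeping for a colouring split along an island candidate `Y` (`s = s₀ ∪ s₁`, `s₀ ⊆ E_Y`, `s₁ ⊆ E \ E_Y`): the class condition
`Y_max(s) = Y ∧ wall` is `(Y island for s₀ ∧ wall inside) ∧ (wall outside ∧ s₁ prime)`, and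
      then the clusters outside `Y` are those of the quotient and
inside those of `G[Y]`. [cite: KozmaNitzan2024, §5.5 (context only)] -/
theorem islandClass_pointwise (ends : ι → Sym2 V) (E : Finset ι) (Vs : Finset V) (x w : V) (Z : Set V) (Y : Finset V)
    (hYV : Y ⊆ Vs) (hxY : x ∈ Y) (hwY : w ∉ Y) (hwx : w ≠ x)
    (s₀ s₁ : Finset ι) (hs₀ : s₀ ⊆ E.filter (fun i => ∀ y ∈ ends i, y ∈ Y)) (hs₁ : s₁ ⊆ E \ E.filter (fun i => ∀ y ∈ ends i, y ∈ Y)) :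
    (((Vs.filter (fun v : V => ∃ Y : Finset V, Y ⊆ Vs ∧ x ∈ Y ∧ w ∉ Y ∧
        (∀ t ∈ Y, t ≠ x → (∃ i ∈ E, ∃ t', ends i = s(t, t') ∧ t' ∉ Y) →
          t ∈ openCluster (ends '' (↑((s₀ ∪ s₁).filter (fun i => ∀ y ∈ ends i, y ∈ Y)) : Set ι)) x ∧ t ∈ openCluster (ends '' (↑((E \ (s₀
                ∪ s₁)).filter (fun i => ∀ y ∈ ends i, y ∈ Y)) : Set ι)) x) ∧ v ∈ Y)) = Y ∧
      (∀ z ∈ Z, z ∉ openCluster (ends '' (↑(s₀ ∪ s₁) : Set ι)) x ∧ z ∉ openCluster (ends '' (↑(E \ (s₀ ∪ s₁)) : Set ι)) x)) ↔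
     (((∀ t ∈ Y, t ≠ x → (∃ i ∈ E, ∃ t', ends i = s(t, t') ∧ t' ∉ Y) →
          t ∈ openCluster (ends '' (↑(s₀) : Set ι)) x ∧ t ∈ openCluster (ends '' (↑(E.filter (fun i => ∀ y ∈ ends i, y ∈ Y) \ s₀) : Set ι)) x) ∧
       (∀ z ∈ Z, z ∈ Y → z ∉ openCluster (ends '' (↑(s₀) : Set ι)) x ∧ z ∉ openCluster
             (ends '' (↑(E.filter (fun i => ∀ y ∈ ends i, y ∈ Y) \ s₀) : Set ι)) x)) ∧
      ((∀ z ∈ Z, z ∉ Y → z ∉ openCluster (ends '' (↑(s₁ ∪ E.filter (fun i => ∀ y ∈ ends i, y ∈ Y)) : Set ι)) x ∧ z ∉ openCluster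
            (ends '' (↑(((E \ E.filter (fun i => ∀ y ∈ ends i, y ∈ Y)) \ s₁) ∪ E.filter (fun i => ∀ y ∈ ends i, y ∈ Y)) : Set ι)) x) ∧
       (∀ Y' : Finset V, Y ⊆ Y' → Y ≠ Y' → Y' ⊆ Vs → w ∉ Y' →
          ¬ (∀ t ∈ Y', t ≠ x → (∃ i ∈ E, ∃ t', ends i = s(t, t') ∧ t' ∉ Y') →
          t ∈ openCluster (ends '' (↑(((s₁ ∪ E.filter (fun i => ∀ y ∈ ends i, y ∈ Y))).filter (fun i => ∀ y ∈ ends i, y ∈ Y')) : Set ι)) x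
                ∧ t ∈ openCluster (ends '' (↑((((E \ E.filter (fun i => ∀ y ∈ ends i, y ∈ Y)) \ s₁)
                ∪ E.filter (fun i => ∀ y ∈ ends i, y ∈ Y)).filter (fun i => ∀ y ∈ ends i, y ∈ Y')) : Set ι)) x))))) ∧
    ((∀ t ∈ Y, t ≠ x → (∃ i ∈ E, ∃ t', ends i = s(t, t') ∧ t' ∉ Y) →
          t ∈ openCluster (ends '' (↑(s₀) : Set ι)) x ∧ t ∈ openCluster (ends '' (↑(E.filter (fun i => ∀ y ∈ ends i, y ∈ Y) \ s₀) : Set ι)) x) →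
      (∀ v, v ∉ Y → ((v ∈ openCluster (ends '' (↑(s₀ ∪ s₁) : Set ι)) x ↔ v ∈ openCluster (ends '' (↑(s₁
            ∪ E.filter (fun i => ∀ y ∈ ends i, y ∈ Y)) : Set ι)) x) ∧ (v ∈ openCluster (ends '' (↑(E \ (s₀ ∪ s₁)) : Set ι)) x ↔ v ∈ openCluster
            (ends '' (↑(((E \ E.filter (fun i => ∀ y ∈ ends i, y ∈ Y)) \ s₁) ∪ E.filter (fun i => ∀ y ∈ ends i, y ∈ Y)) : Set ι)) x))) ∧
      (∀ v, v ∈ Y → ((v ∈ openCluster (ends '' (↑(s₀ ∪ s₁) : Set ι)) x ↔ v ∈ openCluster (ends '' (↑(s₀) : Set ι)) x) ∧ (v ∈ openCluster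
            (ends '' (↑(E \ (s₀ ∪ s₁)) : Set ι)) x ↔ v ∈ openCluster (ends '' (↑(E.filter (fun i => ∀ y ∈ ends i, y ∈ Y) \ s₀) : Set ι)) x)))) := by
  set EY : Finset ι := E.filter (fun i => ∀ y ∈ ends i, y ∈ Y) with hEY
  have hEYE : EY ⊆ E := Finset.filter_subset _ _
  have hdisj : Disjoint EY (E \ EY) := Finset.disjoint_sdiff
  have memEY : ∀ {i : ι}, i ∈ EY ↔ i ∈ E ∧ ∀ y ∈ ends i, y ∈ Y := fun {i} => by rw [hEY, Finset.mem_filter]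
  have hs₁E : s₁ ⊆ E := fun i hi => (Finset.mem_sdiff.mp (hs₁ hi)).1
  have hcE : s₀ ∪ s₁ ⊆ E := Finset.union_subset (hs₀.trans hEYE) hs₁E
  have e1 : (s₀ ∪ s₁).filter (fun i => ∀ y ∈ ends i, y ∈ Y) = s₀ := by
    ext i
    rw [Finset.mem_filter, Finset.mem_union]
    constructor
    · rintro ⟨hi | hi, hin⟩
      · exact hi
      · exact absurd (memEY.mpr ⟨hs₁E hi, hin⟩) (Finset.mem_sdiff.mp (hs₁ hi)).2
    · intro hi
      exact ⟨Or.inl hi, (memEY.mp (hs₀ hi)).2⟩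
  have e2 : E \ (s₀ ∪ s₁) = (EY \ s₀) ∪ ((E \ EY) \ s₁) := by
    conv_lhs => rw [← Finset.union_sdiff_of_subset hEYE]
    exact union_sdiff_union_of_subset hdisj hs₀ hs₁
  have e3 : (E \ (s₀ ∪ s₁)).filter (fun i => ∀ y ∈ ends i, y ∈ Y) = EY \ s₀ := by
    rw [e2]
    ext i
    rw [Finset.mem_filter, Finset.mem_union, Finset.mem_sdiff, Finset.mem_sdiff, Finset.mem_sdiff]
    constructor
    · rintro ⟨⟨hiY, hni⟩ | ⟨⟨hiE, hniY⟩, -⟩, hin⟩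
      · exact ⟨hiY, hni⟩
      · exact absurd (memEY.mpr ⟨hiE, hin⟩) hniY
    · rintro ⟨hiY, hni⟩
      exact ⟨Or.inl ⟨hiY, hni⟩, (memEY.mp hiY).2⟩
  have e4 : (s₀ ∪ s₁) ∪ EY = s₁ ∪ EY := by
    ext i
    simp only [Finset.mem_union]
    constructor
    · rintro ((hi | hi) | hi)
      · exact Or.inr (hs₀ hi)
      · exact Or.inl hi
      · exact Or.inr hi
    · rintro (hi | hi)
      · exact Or.inl (Or.inr hi)
      · exact Or.inr hi
  have e5 : (E \ (s₀ ∪ s₁)) ∪ EY = ((E \ EY) \ s₁) ∪ EY := by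
    rw [e2]
    ext i
    simp only [Finset.mem_union, Finset.mem_sdiff]
    constructor
    · rintro ((⟨hiY, -⟩ | h) | hi)
      · exact Or.inr hiY
      · exact Or.inl h
      · exact Or.inr hi
    · rintro (h | hi)
      · exact Or.inl (Or.inr h)
      · exact Or.inr hi
  -- the island condition of `s₀ ∪ s₁` for `Y` is that of `s₀`
  have hIsl : (∀ t ∈ Y, t ≠ x → (∃ i ∈ E, ∃ t', ends i = s(t, t') ∧ t' ∉ Y) →
          t ∈ openCluster (ends '' (↑((s₀ ∪ s₁).filter (fun i => ∀ y ∈ ends i, y ∈ Y)) : Set ι)) x ∧ t ∈ openCluster (ends '' (↑((E \ (s₀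
                ∪ s₁)).filter (fun i => ∀ y ∈ ends i, y ∈ Y)) : Set ι)) x) ↔
      (∀ t ∈ Y, t ≠ x → (∃ i ∈ E, ∃ t', ends i = s(t, t') ∧ t' ∉ Y) →
          t ∈ openCluster (ends '' (↑(s₀) : Set ι)) x ∧ t ∈ openCluster (ends '' (↑(E.filter (fun i => ∀ y ∈ ends i, y ∈ Y) \ s₀) : Set ι)) x) := by
    rw [e1, e3]
  -- readings under the island hypothesis (Lemma A)
  have readings : (∀ t ∈ Y, t ≠ x → (∃ i ∈ E, ∃ t', ends i = s(t, t') ∧ t' ∉ Y) →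
          t ∈ openCluster (ends '' (↑(s₀) : Set ι)) x ∧ t ∈ openCluster (ends '' (↑(E.filter (fun i => ∀ y ∈ ends i, y ∈ Y) \ s₀) : Set ι)) x) →
      (∀ v, v ∉ Y → ((v ∈ openCluster (ends '' (↑(s₀ ∪ s₁) : Set ι)) x ↔ v ∈ openCluster (ends '' (↑(s₁
            ∪ E.filter (fun i => ∀ y ∈ ends i, y ∈ Y)) : Set ι)) x) ∧ (v ∈ openCluster (ends '' (↑(E \ (s₀ ∪ s₁)) : Set ι)) x ↔ v ∈ openCluster
            (ends '' (↑(((E \ E.filter (fun i => ∀ y ∈ ends i, y ∈ Y)) \ s₁) ∪ E.filter (fun i => ∀ y ∈ ends i, y ∈ Y)) : Set ι)) x))) ∧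
      (∀ v, v ∈ Y → ((v ∈ openCluster (ends '' (↑(s₀ ∪ s₁) : Set ι)) x ↔ v ∈ openCluster (ends '' (↑(s₀) : Set ι)) x) ∧ (v ∈ openCluster
            (ends '' (↑(E \ (s₀ ∪ s₁)) : Set ι)) x ↔ v ∈ openCluster (ends '' (↑(E.filter (fun i => ∀ y ∈ ends i, y ∈ Y) \ s₀) : Set ι)) x))) := by
    intro hP
    -- Set-form island hypotheses for the two colours
    have hredI : ∀ t ∈ (↑Y : Set V), t ≠ x → (∃ i ∈ E, ∃ t', ends i = s(t, t') ∧ t' ∉ (↑Y : Set V)) →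
        t ∈ openCluster (ends '' (↑((s₀ ∪ s₁).filter (fun i => ∀ y ∈ ends i, y ∈ (↑Y : Set V))) : Set ι)) x := by
      intro t ht htx hbd
      obtain ⟨i, hi, t', he, ht'⟩ := hbd
      have h := (hP t (Finset.mem_coe.mp ht) htx ⟨i, hi, t', he, fun h => ht' (Finset.mem_coe.mpr h)⟩).1
      refine openCluster_image_mono ends ?_ x h
      intro j hj
      rw [Finset.mem_filter]
      exact ⟨Finset.mem_union_left _ hj, fun y hy => Finset.mem_coe.mpr ((memEY.mp (hs₀ hj)).2 y hy)⟩
    have hblueI : ∀ t ∈ (↑Y : Set V), t ≠ x → (∃ i ∈ E, ∃ t', ends i = s(t, t') ∧ t' ∉ (↑Y : Set V)) →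
        t ∈ openCluster (ends '' (↑((E \ (s₀ ∪ s₁)).filter (fun i => ∀ y ∈ ends i, y ∈ (↑Y : Set V))) : Set ι)) x := by
      intro t ht htx hbd
      obtain ⟨i, hi, t', he, ht'⟩ := hbd
      have h := (hP t (Finset.mem_coe.mp ht) htx ⟨i, hi, t', he, fun h => ht' (Finset.mem_coe.mpr h)⟩).2
      refine openCluster_image_mono ends ?_ x h
      intro j hj
      rw [Finset.mem_sdiff] at hj
      rw [Finset.mem_filter, e2, Finset.mem_union]
      exact ⟨Or.inl (Finset.mem_sdiff.mpr hj), fun y hy => Finset.mem_coe.mpr ((memEY.mp hj.1).2 y hy)⟩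
    -- identify `E.filter (inside ↑Y)` with `EY`
    have eEY : E.filter (fun i => ∀ y ∈ ends i, y ∈ (↑Y : Set V)) = EY := by
      rw [hEY]
      exact Finset.filter_congr fun i _ => by simp only [Finset.mem_coe]
    have eF0 : (s₀ ∪ s₁).filter (fun i => ∀ y ∈ ends i, y ∈ (↑Y : Set V)) = s₀ := by
      have h : (s₀ ∪ s₁).filter (fun i => ∀ y ∈ ends i, y ∈ (↑Y : Set V)) = (s₀ ∪ s₁).filter (fun i => ∀ y ∈ ends i, y ∈ Y) :=
        Finset.filter_congr fun i _ => by simp only [Finset.mem_coe]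
      rw [h, e1]
    have eF1 : (E \ (s₀ ∪ s₁)).filter (fun i => ∀ y ∈ ends i, y ∈ (↑Y : Set V)) = EY \ s₀ := by
      have h : (E \ (s₀ ∪ s₁)).filter (fun i => ∀ y ∈ ends i, y ∈ (↑Y : Set V)) = (E \ (s₀ ∪ s₁)).filter (fun i => ∀ y ∈ ends i, y ∈ Y) :=
        Finset.filter_congr fun i _ => by simp only [Finset.mem_coe]
      rw [h, e3]
    have hxY' : x ∈ (↑Y : Set V) := Finset.mem_coe.mpr hxY
    constructor
    · intro v hv
      have hv' : v ∉ (↑Y : Set V) := fun h => hv (Finset.mem_coe.mp h)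
      have hR := mem_openCluster_iff_union_of_island ends E (s₀ ∪ s₁) hcE x (↑Y : Set V) hxY' hredI hv'
      have hB := mem_openCluster_iff_union_of_island ends E (E \ (s₀ ∪ s₁)) Finset.sdiff_subset x (↑Y : Set V) hxY' hblueI hv'
      rw [eEY, e4] at hR
      rw [eEY, e5] at hB
      exact ⟨hR, hB⟩
    · intro v hv
      have hv' : v ∈ (↑Y : Set V) := Finset.mem_coe.mpr hv
      have hR := mem_openCluster_iff_inter_of_island ends E (s₀ ∪ s₁) hcE x (↑Y : Set V) hxY' hredI hv'
      have hB := mem_openCluster_iff_inter_of_island ends E (E \ (s₀ ∪ s₁)) Finset.sdiff_subset x (↑Y : Set V) hxY' hblueI hv'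
      rw [eF0] at hR
      rw [eF1] at hB
      exact ⟨hR, hB⟩
  refine ⟨?_, readings⟩
  -- the class condition
  rw [islandSup_eq_iff ends E (s₀ ∪ s₁) x w Vs (hYV hxY) hwx Y]
  constructor
  · rintro ⟨⟨-, -, -, hI, hmax⟩, hW⟩
    have hP := hIsl.mp hI
    obtain ⟨hout, hin⟩ := readings hP
    refine ⟨⟨hP, fun z hz hzY => ?_⟩, fun z hz hzY => ?_, ?_⟩
    · exact ⟨fun h => (hW z hz).1 ((hin z hzY).1.mpr h), fun h => (hW z hz).2 ((hin z hzY).2.mpr h)⟩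
    · exact ⟨fun h => (hW z hz).1 ((hout z hzY).1.mpr h), fun h => (hW z hz).2 ((hout z hzY).2.mpr h)⟩
    · intro Y' hYY' hne hY'V hwY' hq
      refine hmax Y' hYY' hne hY'V hwY' ?_
      have hB := island_iff_quotient_of_subset ends E (s₀ ∪ s₁) hcE x Y Y' hxY hYY' hI
      rw [e4, e5] at hB
      exact hB.mpr hq
  · rintro ⟨⟨hP, hWin⟩, hWout, hprime⟩
    have hI := hIsl.mpr hP
    obtain ⟨hout, hin⟩ := readings hP
    refine ⟨⟨hYV, hxY, hwY, hI, ?_⟩, ?_⟩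
    · intro Y' hYY' hne hY'V hwY' hI'
      refine hprime Y' hYY' hne hY'V hwY' ?_
      have hB := island_iff_quotient_of_subset ends E (s₀ ∪ s₁) hcE x Y Y' hxY hYY' hI
      rw [e4, e5] at hB
      exact hB.mp hI'
    · intro z hz
      by_cases hzY : z ∈ Y
      · exact ⟨fun h => (hWin z hz hzY).1 ((hin z hzY).1.mp h), fun h => (hWin z hz hzY).2 ((hin z hzY).2.mp h)⟩
      · exact ⟨fun h => (hWout z hz hzY).1 ((hout z hzY).1.mp h), fun h => (hWout z hz hzY).2 ((hout z hzY).2.mp h)⟩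

open Classical in
/-- **The class of a maximal island factorises** (`u, w ∉ Y`): the point-row sum over the wall colourings `s = s₀ ∪ s₁` with `Y_max(s) = Y` equals
`N_isl(Y) · R_Y`. [cite: KozmaNitzan2024, Questions 8–9 (§5.5 p. 36) (context)] -/
theorem islandClass_sum (ends : ι → Sym2 V) (E : Finset ι) (Vs : Finset V) (x u w : V) (Z : Set V) (Y : Finset V)
    (hYV : Y ⊆ Vs) (hxY : x ∈ Y) (huY : u ∉ Y) (hwY : w ∉ Y) (hwx : w ≠ x) :
    ∑ s₀ ∈ (E.filter (fun i => ∀ y ∈ ends i, y ∈ Y)).powerset, ∑ s₁ ∈ (E \ E.filter (fun i => ∀ y ∈ ends i, y ∈ Y)).powerset,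
        (if (Vs.filter (fun v : V => ∃ Y : Finset V, Y ⊆ Vs ∧ x ∈ Y ∧ w ∉ Y ∧
        (∀ t ∈ Y, t ≠ x → (∃ i ∈ E, ∃ t', ends i = s(t, t') ∧ t' ∉ Y) →
          t ∈ openCluster (ends '' (↑((s₀ ∪ s₁).filter (fun i => ∀ y ∈ ends i, y ∈ Y)) : Set ι)) x ∧ t ∈ openCluster (ends '' (↑((E \ (s₀
                ∪ s₁)).filter (fun i => ∀ y ∈ ends i, y ∈ Y)) : Set ι)) x) ∧ v ∈ Y)) = Y ∧
            (∀ z ∈ Z, z ∉ openCluster (ends '' (↑(s₀ ∪ s₁) : Set ι)) x ∧ z ∉ openCluster (ends '' (↑(E \ (s₀ ∪ s₁)) : Set ι)) x)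
          then ((if u ∈ openCluster (ends '' (↑(s₀ ∪ s₁) : Set ι)) x then (1 : ℝ) else 0) - (if u ∈ openCluster (ends '' (↑(E \ (s₀
                ∪ s₁)) : Set ι)) x then (1 : ℝ) else 0)) *
            ((if w ∈ openCluster (ends '' (↑(s₀ ∪ s₁) : Set ι)) x then (1 : ℝ) else 0) - (if w ∈ openCluster (ends '' (↑(E \ (s₀
                  ∪ s₁)) : Set ι)) x then (1 : ℝ) else 0)) else 0)
    = (((E.filter (fun i => ∀ y ∈ ends i, y ∈ Y)).powerset.filter (fun s₀ : Finset ι =>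
          (∀ t ∈ Y, t ≠ x → (∃ i ∈ E, ∃ t', ends i = s(t, t') ∧ t' ∉ Y) →
          t ∈ openCluster (ends '' (↑(s₀) : Set ι)) x ∧ t ∈ openCluster (ends '' (↑(E.filter (fun i => ∀ y ∈ ends i, y ∈ Y) \ s₀) : Set ι)) x) ∧
          (∀ z ∈ Z, z ∈ Y → z ∉ openCluster (ends '' (↑(s₀) : Set ι)) x ∧ z ∉ openCluster
                (ends '' (↑(E.filter (fun i => ∀ y ∈ ends i, y ∈ Y) \ s₀) : Set ι)) x))).card : ℝ) *
      ∑ s₁ ∈ (E \ E.filter (fun i => ∀ y ∈ ends i, y ∈ Y)).powerset.filter (fun s₁ : Finset ι =>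
          (∀ z ∈ Z, z ∉ Y → z ∉ openCluster (ends '' (↑(s₁ ∪ E.filter (fun i => ∀ y ∈ ends i, y ∈ Y)) : Set ι)) x ∧ z ∉ openCluster
                (ends '' (↑(((E \ E.filter (fun i => ∀ y ∈ ends i, y ∈ Y)) \ s₁) ∪ E.filter (fun i => ∀ y ∈ ends i, y ∈ Y)) : Set ι)) x) ∧
          (∀ Y' : Finset V, Y ⊆ Y' → Y ≠ Y' → Y' ⊆ Vs → w ∉ Y' →
          ¬ (∀ t ∈ Y', t ≠ x → (∃ i ∈ E, ∃ t', ends i = s(t, t') ∧ t' ∉ Y') →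
          t ∈ openCluster (ends '' (↑(((s₁ ∪ E.filter (fun i => ∀ y ∈ ends i, y ∈ Y))).filter (fun i => ∀ y ∈ ends i, y ∈ Y')) : Set ι)) x
                ∧ t ∈ openCluster (ends '' (↑((((E \ E.filter (fun i => ∀ y ∈ ends i, y ∈ Y)) \ s₁)
                ∪ E.filter (fun i => ∀ y ∈ ends i, y ∈ Y)).filter (fun i => ∀ y ∈ ends i, y ∈ Y')) : Set ι)) x))),
        ((if u ∈ openCluster (ends '' (↑(s₁ ∪ E.filter (fun i => ∀ y ∈ ends i, y ∈ Y)) : Set ι)) x then (1 : ℝ) else 0) - (if u ∈ openCluster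
              (ends '' (↑(((E \ E.filter (fun i => ∀ y ∈ ends i, y ∈ Y)) \ s₁) ∪ E.filter (fun i => ∀ y ∈ ends i, y ∈ Y)) : Set ι)) x
              then (1 : ℝ) else 0)) *
          ((if w ∈ openCluster (ends '' (↑(s₁ ∪ E.filter (fun i => ∀ y ∈ ends i, y ∈ Y)) : Set ι)) x then (1 : ℝ) else 0) - (if w ∈ openCluster
                (ends '' (↑(((E \ E.filter (fun i => ∀ y ∈ ends i, y ∈ Y)) \ s₁) ∪ E.filter (fun i => ∀ y ∈ ends i, y ∈ Y)) : Set ι)) x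
                then (1 : ℝ) else 0)) := by
  rw [Finset.natCast_card_filter, Finset.sum_filter, Finset.sum_mul_sum]
  refine Finset.sum_congr rfl fun s₀ hs₀ => Finset.sum_congr rfl fun s₁ hs₁ => ?_
  rw [Finset.mem_powerset] at hs₀ hs₁
  obtain ⟨hclass, hread⟩ := islandClass_pointwise ends E Vs x w Z Y hYV hxY hwY hwx s₀ s₁ hs₀ hs₁
  by_cases hP : (∀ t ∈ Y, t ≠ x → (∃ i ∈ E, ∃ t', ends i = s(t, t') ∧ t' ∉ Y) →
          t ∈ openCluster (ends '' (↑(s₀) : Set ι)) x ∧ t ∈ openCluster (ends '' (↑(E.filter (fun i => ∀ y ∈ ends i, y ∈ Y) \ s₀) : Set ι)) x)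
  swap
  · have c1 : ¬ ((Vs.filter (fun v : V => ∃ Y : Finset V, Y ⊆ Vs ∧ x ∈ Y ∧ w ∉ Y ∧
        (∀ t ∈ Y, t ≠ x → (∃ i ∈ E, ∃ t', ends i = s(t, t') ∧ t' ∉ Y) →
          t ∈ openCluster (ends '' (↑((s₀ ∪ s₁).filter (fun i => ∀ y ∈ ends i, y ∈ Y)) : Set ι)) x ∧ t ∈ openCluster (ends '' (↑((E \ (s₀
                ∪ s₁)).filter (fun i => ∀ y ∈ ends i, y ∈ Y)) : Set ι)) x) ∧ v ∈ Y)) = Y ∧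
        (∀ z ∈ Z, z ∉ openCluster (ends '' (↑(s₀ ∪ s₁) : Set ι)) x ∧ z ∉ openCluster (ends '' (↑(E \ (s₀
              ∪ s₁)) : Set ι)) x)) := fun h => hP (hclass.mp h).1.1
    have c2 : ¬ ((∀ t ∈ Y, t ≠ x → (∃ i ∈ E, ∃ t', ends i = s(t, t') ∧ t' ∉ Y) →
          t ∈ openCluster (ends '' (↑(s₀) : Set ι)) x ∧ t ∈ openCluster (ends '' (↑(E.filter (fun i => ∀ y ∈ ends i, y ∈ Y) \ s₀) : Set ι)) x) ∧
        (∀ z ∈ Z, z ∈ Y → z ∉ openCluster (ends '' (↑(s₀) : Set ι)) x ∧ z ∉ openCluster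
              (ends '' (↑(E.filter (fun i => ∀ y ∈ ends i, y ∈ Y) \ s₀) : Set ι)) x)) := fun h => hP h.1
    rw [if_neg c1, if_neg c2, zero_mul]
  obtain ⟨hout, -⟩ := hread hP
  have hsig : ((if u ∈ openCluster (ends '' (↑(s₀ ∪ s₁) : Set ι)) x then (1 : ℝ) else 0) - (if u ∈ openCluster (ends '' (↑(E \ (s₀
        ∪ s₁)) : Set ι)) x then (1 : ℝ) else 0)) *
        ((if w ∈ openCluster (ends '' (↑(s₀ ∪ s₁) : Set ι)) x then (1 : ℝ) else 0) - (if w ∈ openCluster (ends '' (↑(E \ (s₀ ∪ s₁)) : Set ι)) x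
              then (1 : ℝ) else 0))
      = ((if u ∈ openCluster (ends '' (↑(s₁ ∪ E.filter (fun i => ∀ y ∈ ends i, y ∈ Y)) : Set ι)) x then (1 : ℝ) else 0) - (if u ∈ openCluster
            (ends '' (↑(((E \ E.filter (fun i => ∀ y ∈ ends i, y ∈ Y)) \ s₁) ∪ E.filter (fun i => ∀ y ∈ ends i, y ∈ Y)) : Set ι)) x then (1 : ℝ)
            else 0)) *
        ((if w ∈ openCluster (ends '' (↑(s₁ ∪ E.filter (fun i => ∀ y ∈ ends i, y ∈ Y)) : Set ι)) x then (1 : ℝ) else 0) - (if w ∈ openCluster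
              (ends '' (↑(((E \ E.filter (fun i => ∀ y ∈ ends i, y ∈ Y)) \ s₁) ∪ E.filter (fun i => ∀ y ∈ ends i, y ∈ Y)) : Set ι)) x
              then (1 : ℝ) else 0)) := by
    have h1 : (u ∈ openCluster (ends '' (↑(s₀ ∪ s₁) : Set ι)) x) = (u ∈ openCluster (ends '' (↑(s₁
          ∪ E.filter (fun i => ∀ y ∈ ends i, y ∈ Y)) : Set ι)) x) := propext (hout u huY).1
    have h2 : (u ∈ openCluster (ends '' (↑(E \ (s₀ ∪ s₁)) : Set ι)) x) = (u ∈ openCluster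
          (ends '' (↑(((E \ E.filter (fun i => ∀ y ∈ ends i, y ∈ Y)) \ s₁)
          ∪ E.filter (fun i => ∀ y ∈ ends i, y ∈ Y)) : Set ι)) x) := propext (hout u huY).2
    have h3 : (w ∈ openCluster (ends '' (↑(s₀ ∪ s₁) : Set ι)) x) = (w ∈ openCluster (ends '' (↑(s₁
          ∪ E.filter (fun i => ∀ y ∈ ends i, y ∈ Y)) : Set ι)) x) := propext (hout w hwY).1
    have h4 : (w ∈ openCluster (ends '' (↑(E \ (s₀ ∪ s₁)) : Set ι)) x) = (w ∈ openCluster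
          (ends '' (↑(((E \ E.filter (fun i => ∀ y ∈ ends i, y ∈ Y)) \ s₁)
          ∪ E.filter (fun i => ∀ y ∈ ends i, y ∈ Y)) : Set ι)) x) := propext (hout w hwY).2
    simp only [h1, h2, h3, h4]
  rw [hsig]
  by_cases hA : (∀ z ∈ Z, z ∈ Y → z ∉ openCluster (ends '' (↑(s₀) : Set ι)) x ∧ z ∉ openCluster
        (ends '' (↑(E.filter (fun i => ∀ y ∈ ends i, y ∈ Y) \ s₀) : Set ι)) x)
  · by_cases hB : (∀ z ∈ Z, z ∉ Y → z ∉ openCluster (ends '' (↑(s₁ ∪ E.filter (fun i => ∀ y ∈ ends i, y ∈ Y)) : Set ι)) x ∧ z ∉ openCluster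
        (ends '' (↑(((E \ E.filter (fun i => ∀ y ∈ ends i, y ∈ Y)) \ s₁) ∪ E.filter (fun i => ∀ y ∈ ends i, y ∈ Y)) : Set ι)) x) ∧
        (∀ Y' : Finset V, Y ⊆ Y' → Y ≠ Y' → Y' ⊆ Vs → w ∉ Y' →
          ¬ (∀ t ∈ Y', t ≠ x → (∃ i ∈ E, ∃ t', ends i = s(t, t') ∧ t' ∉ Y') →
          t ∈ openCluster (ends '' (↑(((s₁ ∪ E.filter (fun i => ∀ y ∈ ends i, y ∈ Y))).filter (fun i => ∀ y ∈ ends i, y ∈ Y')) : Set ι)) x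
                ∧ t ∈ openCluster (ends '' (↑((((E \ E.filter (fun i => ∀ y ∈ ends i, y ∈ Y)) \ s₁)
                ∪ E.filter (fun i => ∀ y ∈ ends i, y ∈ Y)).filter (fun i => ∀ y ∈ ends i, y ∈ Y')) : Set ι)) x))
    · have c1 : (Vs.filter (fun v : V => ∃ Y : Finset V, Y ⊆ Vs ∧ x ∈ Y ∧ w ∉ Y ∧
        (∀ t ∈ Y, t ≠ x → (∃ i ∈ E, ∃ t', ends i = s(t, t') ∧ t' ∉ Y) →
          t ∈ openCluster (ends '' (↑((s₀ ∪ s₁).filter (fun i => ∀ y ∈ ends i, y ∈ Y)) : Set ι)) x ∧ t ∈ openCluster (ends '' (↑((E \ (s₀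
                ∪ s₁)).filter (fun i => ∀ y ∈ ends i, y ∈ Y)) : Set ι)) x) ∧ v ∈ Y)) = Y ∧
          (∀ z ∈ Z, z ∉ openCluster (ends '' (↑(s₀ ∪ s₁) : Set ι)) x ∧ z ∉ openCluster (ends '' (↑(E \ (s₀
                ∪ s₁)) : Set ι)) x) := hclass.mpr ⟨⟨hP, hA⟩, hB⟩
      have c2 : (∀ t ∈ Y, t ≠ x → (∃ i ∈ E, ∃ t', ends i = s(t, t') ∧ t' ∉ Y) →
          t ∈ openCluster (ends '' (↑(s₀) : Set ι)) x ∧ t ∈ openCluster (ends '' (↑(E.filter (fun i => ∀ y ∈ ends i, y ∈ Y) \ s₀) : Set ι)) x) ∧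
          (∀ z ∈ Z, z ∈ Y → z ∉ openCluster (ends '' (↑(s₀) : Set ι)) x ∧ z ∉ openCluster
                (ends '' (↑(E.filter (fun i => ∀ y ∈ ends i, y ∈ Y) \ s₀) : Set ι)) x) := ⟨hP, hA⟩
      rw [if_pos c1, if_pos c2, if_pos hB, one_mul]
    · have c1 : ¬ ((Vs.filter (fun v : V => ∃ Y : Finset V, Y ⊆ Vs ∧ x ∈ Y ∧ w ∉ Y ∧
        (∀ t ∈ Y, t ≠ x → (∃ i ∈ E, ∃ t', ends i = s(t, t') ∧ t' ∉ Y) →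
          t ∈ openCluster (ends '' (↑((s₀ ∪ s₁).filter (fun i => ∀ y ∈ ends i, y ∈ Y)) : Set ι)) x ∧ t ∈ openCluster (ends '' (↑((E \ (s₀
                ∪ s₁)).filter (fun i => ∀ y ∈ ends i, y ∈ Y)) : Set ι)) x) ∧ v ∈ Y)) = Y ∧
          (∀ z ∈ Z, z ∉ openCluster (ends '' (↑(s₀ ∪ s₁) : Set ι)) x ∧ z ∉ openCluster (ends '' (↑(E \ (s₀
                ∪ s₁)) : Set ι)) x)) := fun h => hB (hclass.mp h).2
      rw [if_neg c1, if_neg hB, mul_zero]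
  · have c1 : ¬ ((Vs.filter (fun v : V => ∃ Y : Finset V, Y ⊆ Vs ∧ x ∈ Y ∧ w ∉ Y ∧
        (∀ t ∈ Y, t ≠ x → (∃ i ∈ E, ∃ t', ends i = s(t, t') ∧ t' ∉ Y) →
          t ∈ openCluster (ends '' (↑((s₀ ∪ s₁).filter (fun i => ∀ y ∈ ends i, y ∈ Y)) : Set ι)) x ∧ t ∈ openCluster (ends '' (↑((E \ (s₀
                ∪ s₁)).filter (fun i => ∀ y ∈ ends i, y ∈ Y)) : Set ι)) x) ∧ v ∈ Y)) = Y ∧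
        (∀ z ∈ Z, z ∉ openCluster (ends '' (↑(s₀ ∪ s₁) : Set ι)) x ∧ z ∉ openCluster (ends '' (↑(E \ (s₀
              ∪ s₁)) : Set ι)) x)) := fun h => hA (hclass.mp h).1.2
    have c2 : ¬ ((∀ t ∈ Y, t ≠ x → (∃ i ∈ E, ∃ t', ends i = s(t, t') ∧ t' ∉ Y) →
          t ∈ openCluster (ends '' (↑(s₀) : Set ι)) x ∧ t ∈ openCluster (ends '' (↑(E.filter (fun i => ∀ y ∈ ends i, y ∈ Y) \ s₀) : Set ι)) x) ∧
        (∀ z ∈ Z, z ∈ Y → z ∉ openCluster (ends '' (↑(s₀) : Set ι)) x ∧ z ∉ openCluster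
              (ends '' (↑(E.filter (fun i => ∀ y ∈ ends i, y ∈ Y) \ s₀) : Set ι)) x)) := fun h => hA h.2
    rw [if_neg c1, if_neg c2, zero_mul]

end Coefficientwise

end Summit.CriticalPhenomena.PercolationContinuityZ3.Theorems
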